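import Summits.AnomalousDissipation.AnomalousDissipation.Theorems.UniformResolution.Negative.FGTBound
import Summits.AnomalousDissipation.AnomalousDissipation.Theorems.CubicParityLoud.Negative.Clauses

/-!
# Stub `stub_fgtBound` for line `enstrophy-ui-transfer`
# (crux `MomentParity.ResolvedDissipation`, stmt-AnomalousDissipation-14284)

The Foias–Guillopé–Temam weighted `H²` bound (exponent 4) at Galerkin level `N` from ONE stationarity row, with
an `N`- and radius-free constant — the registered stub of the line, now a THIN COROLLARY of the landed
`Theorems/UniformResolution/Negative/FGTBound.lean` (`lintegral_weightedDensity_le_of_fgt`, sibling crux's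
disprover refuter-cdisprove-stmt-AnomalousDissipation-14330-0): the stub's inline weight
`((1 + 4π² Σ_{|k|≤N} |k|²‖û k‖²)⁴)⁻¹` and test field `realTrigPoly (freqBall N) (4π²|k|² û k)` ARE that file's
`fgtWeight N u` and `lapTrunc N u` by definitional unfolding, and the constant is `4(‖f‖₂² + K(ν))/ν²`,
`K(ν) = fgtConst ν = 3072(64/(π⁴ν²)+1)²`.
-/

noncomputable section

-- `Summit.<Summit>.<Problem>`: single-conjunct summit, the duplicate namespace segment is mandated.
set_option linter.dupNamespace false

namespace Summit.AnomalousDissipation.AnomalousDissipation.Theorems.MomentParityResolvedDissipation.FGT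

open MeasureTheory Filter Topology
open scoped ENNReal InnerProductSpace RealInnerProductSpace
open Literature.Analysis.FunctionSpaces Literature.Analysis.FluidPDE
open Summit.AnomalousDissipation.AnomalousDissipation.Theses.MomentParity
open Summit.AnomalousDissipation.AnomalousDissipation.Theorems.CubicParityLoud.Negative (T3 R3 H3 L2T3)
open Summit.AnomalousDissipation.AnomalousDissipation.Theorems.QuarticGate.Negative
  (IsLevel IsBandTest polyGrad IsPolyStationary)
open Summit.AnomalousDissipation.AnomalousDissipation.Theorems.UniformResolution.Negative
  (eLapNormSq fgtWeight lapTrunc fgtConst lintegral_weightedDensity_le_of_fgt)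

/-- **`stub_fgtBound` — the `N`-uniform weighted `H²` bound (exponent 4) from ONE row** (registered stub of line
`enstrophy-ui-transfer`). For every `ν > 0` and smooth `f` there is `C = C(f, ν)` (namely
`4(‖f‖₂² + fgtConst ν)/ν²`) such that every probability law `μ` on `H` carried by level-`N` fields, supported in some
ball `‖u‖ ≤ R`, whose FGT row `u ↦ (1+Z_N u)⁻⁴ ⟨F(u), A P_N u⟩` is integrable with zero mean, satisfies
`∫ |Au|²/(1 + ‖∇u‖²)⁴ dμ ≤ C` — uniformly in `N` and in `R`. Corollary of the landed
`UniformResolution.Negative.lintegral_weightedDensity_le_of_fgt` (the inline weight and test field are `fgtWeight N u`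
and `lapTrunc N u` definitionally); Foias–Guillopé–Temam 1981. [cite: FMRTTurbulence2001, Ch. IV Prop. 3.3 (3.6)] -/
theorem stub_fgtBound :
    ∀ (ν : ℝ) (f : T3 → R3), 0 < ν → Torus.IsSmooth f → ∃ C : ℝ,
    ∀ (N : ℕ) (R : ℝ) (μ : Measure H3), IsProbabilityMeasure μ →
      (∀ᵐ u ∂μ, IsLevel N u) → (∀ᵐ u ∂μ, ‖u‖ ≤ R) →
      Integrable (fun u : H3 =>
        ((1 + 4 * Real.pi ^ 2 * ∑ k ∈ Torus.freqBall N, Torus.freqNormSq k *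
            ‖UnitAddTorus.mFourierCoeff (EuclideanSpace.complexify ∘ (u.1 : T3 → R3)) k‖ ^ 2) ^ 4)⁻¹ *
          Torus.nsGeneratorPairing ν f u (Torus.realTrigPoly (Torus.freqBall N) fun k =>
            (((4 * Real.pi ^ 2 * Torus.freqNormSq k : ℝ)) : ℂ) •
              UnitAddTorus.mFourierCoeff (EuclideanSpace.complexify ∘ (u.1 : T3 → R3)) k)) μ →
      ∫ u, ((1 + 4 * Real.pi ^ 2 * ∑ k ∈ Torus.freqBall N, Torus.freqNormSq k *
            ‖UnitAddTorus.mFourierCoeff (EuclideanSpace.complexify ∘ (u.1 : T3 → R3)) k‖ ^ 2) ^ 4)⁻¹ *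
          Torus.nsGeneratorPairing ν f u (Torus.realTrigPoly (Torus.freqBall N) fun k =>
            (((4 * Real.pi ^ 2 * Torus.freqNormSq k : ℝ)) : ℂ) •
              UnitAddTorus.mFourierCoeff (EuclideanSpace.complexify ∘ (u.1 : T3 → R3)) k) ∂μ = 0 →
      ∫⁻ u, eLapNormSq (u.1 : T3 → R3) / (1 + Torus.eGradNormSq (u.1 : T3 → R3)) ^ 4 ∂μ ≤
        ENNReal.ofReal C := by
  intro ν f hν hf
  refine ⟨4 * ((∫ x, ‖f x‖ ^ 2) + fgtConst ν) / ν ^ 2, fun N R μ hP hL hB hI h0 => ?_⟩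
  haveI := hP
  -- the inline weight / test field are `fgtWeight N u` / `lapTrunc N u` definitionally
  have hI' : Integrable (fun u : H3 => fgtWeight N u * Torus.nsGeneratorPairing ν f u (lapTrunc N u)) μ := hI
  have h0' : ∫ u, fgtWeight N u * Torus.nsGeneratorPairing ν f u (lapTrunc N u) ∂μ = 0 := h0
  exact lintegral_weightedDensity_le_of_fgt hν hf N hB hL hI' h0'

end Summit.AnomalousDissipation.AnomalousDissipation.Theorems.MomentParityResolvedDissipation.FGT

end
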